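import Literature.Topology.FourManifolds.TautFoliationsCollarTame
import Literature.Topology.FourManifolds.TautFoliationsConePositionFine
import HarnessLib

/-!
# The relative cone position of the collar disc with a fine mesh

Sibling of `TautFoliationsCollarTame.lean` and `TautFoliationsConePositionFine.lean`: the cone
position of the collar disc keeping the disc map on the outer-collar edges can be taken with a
mesh at least `N`, so that the outer collar `{7L/8 ≤ dist(·, c₀)}` contains whole rows of grid
squares (for `N ≥ 32`, every square meeting a ring of radius `≥ 15L/16` lies in the
outer collar).

* `exists_conePosition_collar_ge` (**proved**), `sq_subset_collar_of_mesh` (**proved**).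

All statements are [folklore].
-/

noncomputable section

open Set Filter Metric Topology Function Real
open scoped unitInterval

namespace Literature.Topology.FourManifolds

namespace Foliation

open SquareGrid SquareGrid.Grid SquarePolar

variable {c₀ : ℝ × ℝ} {L : ℝ}
variable {B : Type*} [NormedAddCommGroup B] [NormedSpace ℝ B] {M : Type*} [TopologicalSpace M] {F : Foliation B M}
variable {Γ : C(I, F.GermSpace)} {τ₀ ε : ℝ} {Φ : I → ℝ → M}

/-- **A cone position of the collar disc with mesh at least `N`, keeping the disc map on the
outer-collar edges.** [folklore] -/
theorem exists_conePosition_collar_ge [ProperSpace B] [T2Space M] (ho : F.IsTransverselyOriented)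
    (hΦ : IsFenceOn F Γ τ₀ ε Φ univ) (hcl : ∀ τ ∈ Ioo (τ₀ - ε) (τ₀ + ε), Φ 1 τ = Φ 0 τ)
    {τ₁ : ℝ} (hτI : uIcc τ₀ τ₁ ⊆ Ioo (τ₀ - ε) (τ₀ + ε)) (hL : 0 < L) {G : ℝ × ℝ → M} (hGc : Continuous G)
    (hG : ∀ x, L / 2 ≤ dist x c₀ → G x = Φ (angleParam c₀ x) (levelOfParam τ₀ τ₁ (1 - dist x c₀ / L))) (N : ℕ) :
    ∃ P : ConePosition F G c₀ hL, N ≤ P.n ∧ ∀ q k, P.gr.edge q k '' Icc 0 (2 * P.gr.ℓ) ⊆ {x | 7 * L / 8 ≤ dist x c₀} →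
      ∀ s ∈ Icc 0 (2 * P.gr.ℓ), P.skel (P.gr.edge q k s) = G (P.gr.edge q k s) := by
  refine IsTransverselyOriented.exists_conePosition_rel_ge ho hL hGc.continuousOn {x | 7 * L / 8 ≤ dist x c₀} N ?_ ?_
  · intro n hn e he q k hb hsrc
    refine isTameOn_height_collarDisc hΦ hcl hτI hL hGc hG hn he q k (fun s hs ↦ ?_) hsrc
    rw [dist_edge_of_isBoundaryEdge hL hn hb hs]
    linarith
  · intro n hn e he q k hT hsrc
    exact isTameOn_height_collarDisc hΦ hcl hτI hL hGc hG hn he q k (fun s hs ↦ hT (mem_image_of_mem _ hs)) hsrc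

omit [NormedSpace ℝ B] in
/-- **Squares meeting a ring well inside the outer collar lie in the outer collar** when the mesh
is fine: if `32 ≤ n` and the square of the grid of `closedBall c₀ L` contains a point at distance
`R ≥ 15L/16` from `c₀`, then all its points are at distance `≥ 7L/8`. [folklore] -/
theorem sq_subset_collar_of_mesh (hL : 0 < L) {n : ℕ} (hn : 0 < n) (hn32 : 32 ≤ n) (q : Fin n × Fin n)
    {x₀ : ℝ × ℝ} (hx₀ : x₀ ∈ (grid c₀ hL hn).sq q) {R : ℝ} (hR : 15 * L / 16 ≤ R) (hx₀R : dist x₀ c₀ = R) :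
    ∀ x ∈ (grid c₀ hL hn).sq q, 7 * L / 8 ≤ dist x c₀ := by
  intro x hx
  have hℓ : (grid c₀ hL hn).ℓ = L / n := grid_ℓ hL hn
  have hn' : (32 : ℝ) ≤ n := by exact_mod_cast hn32
  have hℓle : (grid c₀ hL hn).ℓ ≤ L / 32 := by
    rw [hℓ]; exact div_le_div_of_nonneg_left hL.le (by norm_num) hn'
  -- both points are within `ℓ` of the centre of the square
  have h1 : dist x (grid c₀ hL hn |>.centre q) ≤ (grid c₀ hL hn).ℓ := mem_closedBall.1 hx
  have h2 : dist x₀ (grid c₀ hL hn |>.centre q) ≤ (grid c₀ hL hn).ℓ := mem_closedBall.1 hx₀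
  have h3 : dist x x₀ ≤ 2 * (grid c₀ hL hn).ℓ := by
    have := dist_triangle x ((grid c₀ hL hn).centre q) x₀
    rw [dist_comm x₀] at h2; linarith
  have h4 := abs_dist_sub_le x x₀ c₀
  rw [hx₀R, abs_le] at h4
  linarith [h4.1]

end Foliation

end Literature.Topology.FourManifolds
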